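import Literature.Computability.MetaComplexity.ResLin
import Literature.Computability.MetaComplexity.ResLinProofs
import Literature.Computability.MetaComplexity.RevResLin
import Literature.Computability.MetaComplexity.ResLinWinningStrategy
import HarnessLib

/-!
# Tree-like Res(⊕) is complete: every unsatisfiable CNF has a tree-like refutation with `< 3·2^N` lines

The lower bounds for TREE-LIKE Res(⊕) refutations in the tree (the tree-like size–width law of
the `ReslinSizeFromWidth` theorems; the Prover–Delayer bounds of `ResLinProverDelayer.lean`,
`ResLinExtensible.lean`, `PigeonholeResLinTreeLike.lean`) quantify over refutations `π` with
`∀ i, (π.map fun l => l.premises.count i).sum ≤ 1` (every line is used as a premise at most once).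
This file records that such refutations EXIST, so that those bounds are not vacuous, with the
textbook upper bound: an unsatisfiable CNF all of whose variables lie in a list `V` of length `N`
has a tree-like Res(⊕) refutation with exactly `3 · 2^N − 1` lines (`exists_treeLike_isResLinRefutation`)
— the complete decision tree on `V` read as a refutation [Itsykson–Sokolov 2020, §2 (completeness of
Res(⊕): "a splitting tree over all variables"); Krajíček 2019, §5.2 (R* is complete)]: the node of a
partial assignment `ρ` on the variables decided so far carries the linear clause
`pathClause ρ done = ⋁_{x ∈ done} (x = ¬ρ(x))` (falsified exactly by the extensions of `ρ`); a leaf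
weakens a clause of `φ` falsified by `ρ` (two lines), an inner node on `x` resolves its two
children on the form `x` (one line); the root clause is empty. The construction appends blocks to
an arbitrary valid prefix (`FreshBlock`: premises inside the block, never its last line, each used
at most once), so no re-indexing of premises is needed.

## References

* D. Itsykson, D. Sokolov, *Resolution over linear equations modulo two*, Ann. Pure Appl. Logic 171
  (2020), §2 [ItsyksonSokolov2020].
* J. Krajíček, *Proof complexity*, CUP 2019, §5.2 (tree-like resolution R*) [KrajicekProofComplexity2019].
-/

namespace Literature.Computability.MetaComplexity

open _root_.Computability Complexity

/-! ### Path clauses -/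

/-- The PATH CLAUSE of the partial assignment `ρ` on the variables `done`: `⋁_{x ∈ done} (x = ¬ρ x)`,
falsified exactly by the assignments agreeing with `ρ` on `done`. [Krajíček 2019, §5.2 (the clause
of a node of a decision tree)] [folklore] -/
def pathClause (ρ : ℕ → Bool) (done : List ℕ) : LinClause :=
  (done.map fun x => ((({x} : Finset ℕ)), !ρ x)).toFinset

/-- The path clause of the empty assignment is the empty clause. [folklore] -/
@[simp] theorem pathClause_nil (ρ : ℕ → Bool) : pathClause ρ [] = ∅ := by
  simp [pathClause]

/-- Deciding one more variable adds one literal. [folklore] -/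
theorem pathClause_cons (ρ : ℕ → Bool) (x : ℕ) (done : List ℕ) :
    pathClause ρ (x :: done) = insert (({x} : Finset ℕ), !ρ x) (pathClause ρ done) := by
  simp [pathClause]

/-- The path clause only depends on the values on `done`. [folklore] -/
theorem pathClause_congr {ρ ρ' : ℕ → Bool} {done : List ℕ} (h : ∀ y ∈ done, ρ y = ρ' y) :
    pathClause ρ done = pathClause ρ' done := by
  unfold pathClause
  congr 1
  exact List.map_congr_left fun y hy => by rw [h y hy]

/-- A clause of `φ` falsified by `ρ`, all of whose variables are decided, lies inside the path
clause (literal-wise). [Krajíček 2019, §5.2 (leaves of the decision tree)] [folklore] -/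
theorem toLinClause_subset_pathClause {ρ : ℕ → Bool} {done : List ℕ} {c : Clause ℕ}
    (hvars : ∀ l ∈ c, l.1 ∈ done) (hfalse : Clause.eval ρ c = false) :
    Clause.toLinClause c ⊆ pathClause ρ done := by
  intro e he
  simp only [Clause.toLinClause, List.mem_toFinset, List.mem_map] at he
  obtain ⟨l, hl, rfl⟩ := he
  have hlit : Literal.eval ρ l = false := by
    have h1 : c.any (Literal.eval ρ) = false := hfalse
    have h2 := List.any_eq_false.1 h1 l hl
    simpa using h2
  simp only [pathClause, List.mem_toFinset, List.mem_map, Literal.toLinLit]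
  refine ⟨l.1, hvars l hl, ?_⟩
  simp only [Literal.eval] at hlit
  obtain ⟨x, b⟩ := l
  simp only [Prod.mk.injEq, true_and]
  revert hlit
  cases ρ x <;> cases b <;> simp

/-! ### Fresh blocks: appending sub-derivations without re-indexing -/

/-- A FRESH BLOCK at offset `off`: a nonempty list of lines whose premise indices all lie inside
the block (`off ≤ p`), never point at the block's last line (`p + 1 < off + |τ|`), and are used at
most once each. Appending fresh blocks to a derivation of length `off` keeps tree-likeness
bookkeeping local. [folklore] -/
structure FreshBlock (off : ℕ) (τ : List ResLinLine) : Prop where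
  /-- the block is nonempty -/
  ne : τ ≠ []
  /-- premises inside the block, never the last line -/
  range : ∀ l ∈ τ, ∀ p ∈ l.premises, off ≤ p ∧ p + 1 < off + τ.length
  /-- every index is used at most once inside the block -/
  count : ∀ i : ℕ, (τ.map fun l => l.premises.count i).sum ≤ 1

/-- Counting premises over a concatenation. [folklore] -/
private theorem sum_count_append (τ₁ τ₂ : List ResLinLine) (i : ℕ) :
    ((τ₁ ++ τ₂).map fun l => l.premises.count i).sum =
      (τ₁.map fun l => l.premises.count i).sum + (τ₂.map fun l => l.premises.count i).sum := by
  rw [List.map_append, List.sum_append]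

/-- A block none of whose lines uses index `i` contributes `0` to its count. [folklore] -/
private theorem sum_count_eq_zero {τ : List ResLinLine} {i : ℕ}
    (h : ∀ l ∈ τ, i ∉ l.premises) : (τ.map fun l => l.premises.count i).sum = 0 := by
  apply List.sum_eq_zero
  intro x hx
  obtain ⟨l, hl, rfl⟩ := List.mem_map.1 hx
  exact List.count_eq_zero.2 (h l hl)

/-- **Gluing two fresh blocks by a binary inference.** If `τ₁` is fresh at `off` and `τ₂` is fresh
at `off + |τ₁|`, then `τ₁ ++ τ₂ ++ [l]`, where the premises of `l` are the last lines of `τ₁` and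
`τ₂`, is fresh at `off`. [folklore] -/
theorem FreshBlock.glue {off : ℕ} {τ₁ τ₂ : List ResLinLine} (h₁ : FreshBlock off τ₁)
    (h₂ : FreshBlock (off + τ₁.length) τ₂) (l : ResLinLine)
    (hl : l.premises = [off + τ₁.length - 1, off + τ₁.length + τ₂.length - 1]) :
    FreshBlock off (τ₁ ++ τ₂ ++ [l]) := by
  have hlen₁ : 0 < τ₁.length := List.length_pos_iff.2 h₁.ne
  have hlen₂ : 0 < τ₂.length := List.length_pos_iff.2 h₂.ne
  refine ⟨by simp, ?_, ?_⟩
  · intro l' hl' p hp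
    simp only [List.length_append, List.length_singleton]
    rcases List.mem_append.1 hl' with hl' | hl'
    · rcases List.mem_append.1 hl' with hl' | hl'
      · have := h₁.range l' hl' p hp; omega
      · have := h₂.range l' hl' p hp; omega
    · rw [List.mem_singleton] at hl'
      subst hl'
      rw [hl] at hp
      simp only [List.mem_cons, List.not_mem_nil, or_false] at hp
      omega
  · intro i
    rw [sum_count_append, sum_count_append]
    simp only [List.map_cons, List.map_nil, List.sum_cons, List.sum_nil, add_zero, hl]
    -- where can `i` be used?
    by_cases hi₁ : i + 1 < off + τ₁.length
    · -- inside `τ₁` (not its last line): only `τ₁` uses it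
      have h2 : (τ₂.map fun l => l.premises.count i).sum = 0 :=
        sum_count_eq_zero fun l' hl' hp => by have := h₂.range l' hl' i hp; omega
      have h3 : [off + τ₁.length - 1, off + τ₁.length + τ₂.length - 1].count i = 0 := by
        apply List.count_eq_zero.2; simp; omega
      rw [h2, h3]; simpa using h₁.count i
    · have h1 : (τ₁.map fun l => l.premises.count i).sum = 0 :=
        sum_count_eq_zero fun l' hl' hp => by have := h₁.range l' hl' i hp; omega
      rw [h1, zero_add]
      by_cases hi₂ : i + 1 = off + τ₁.length
      · -- the last line of `τ₁`: used once, by `l`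
        have h2 : (τ₂.map fun l => l.premises.count i).sum = 0 :=
          sum_count_eq_zero fun l' hl' hp => by have := h₂.range l' hl' i hp; omega
        have h3 : [off + τ₁.length - 1, off + τ₁.length + τ₂.length - 1].count i = 1 :=
          List.count_eq_one_of_mem (by simp; omega) (by simp; omega)
        rw [h2, h3]
      · by_cases hi₃ : i + 1 < off + τ₁.length + τ₂.length
        · -- inside `τ₂` (not its last line): only `τ₂` uses it
          have h3 : [off + τ₁.length - 1, off + τ₁.length + τ₂.length - 1].count i = 0 := by
            apply List.count_eq_zero.2; simp; omega
          rw [h3, add_zero]; exact h₂.count i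
        · have h2 : (τ₂.map fun l => l.premises.count i).sum = 0 :=
            sum_count_eq_zero fun l' hl' hp => by have := h₂.range l' hl' i hp; omega
          rw [h2, zero_add]
          by_cases hi₄ : i + 1 = off + τ₁.length + τ₂.length
          · -- the last line of `τ₂`: used once, by `l`
            have h3 : [off + τ₁.length - 1, off + τ₁.length + τ₂.length - 1].count i = 1 :=
              List.count_eq_one_of_mem (by simp; omega) (by simp; omega)
            rw [h3]
          · -- beyond: unused
            have h3 : [off + τ₁.length - 1, off + τ₁.length + τ₂.length - 1].count i = 0 := by
              apply List.count_eq_zero.2; simp; omega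
            rw [h3]; omega

/-! ### The decision-tree refutation -/

section Construction

variable {φ : CNF ℕ}

/-- **The decision tree as a tree-like derivation, block form.** Let `φ` be unsatisfiable with all
variables in `todo ++ done` (`todo` duplicate-free and disjoint from `done`), `ρ` an assignment
(read on `done`), and `π₀` any Res(⊕) derivation from `φ`. Then `π₀` extends by a fresh block of
exactly `3 · 2^|todo| − 1` lines, still a derivation, whose last line is the path clause of `ρ`
on `done`: branch on the variables of `todo` in order, weaken a falsified clause of `φ` at each
leaf. [Itsykson–Sokolov 2020, §2 (splitting tree over all variables); Krajíček 2019, §5.2]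
[cite: ItsyksonSokolov2020, §2] -/
theorem exists_freshBlock_pathClause (hφ : ¬ φ.Satisfiable) :
    ∀ (todo done : List ℕ) (ρ : ℕ → Bool) (π₀ : List ResLinLine),
      (∀ c ∈ φ, ∀ l ∈ c, l.1 ∈ todo ∨ l.1 ∈ done) → (∀ x ∈ todo, x ∉ done) → todo.Nodup →
      IsResLinDerivation φ π₀ →
      ∃ τ : List ResLinLine, FreshBlock π₀.length τ ∧ IsResLinDerivation φ (π₀ ++ τ) ∧
        (∀ hne : τ ≠ [], (τ.getLast hne).clause = pathClause ρ done) ∧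
        τ.length + 1 = 3 * 2 ^ todo.length := by
  intro todo
  induction todo with
  | nil =>
    intro done ρ π₀ hvars _ _ hπ₀
    -- a clause of `φ` falsified by `ρ`
    obtain ⟨c, hc, hcfalse⟩ : ∃ c ∈ φ, Clause.eval ρ c = false := by
      by_contra h
      push Not at h
      exact hφ ⟨ρ, (CNF.eval_eq_true_iff φ ρ).2 fun c hc => by
        have := h c hc; revert this; cases Clause.eval ρ c <;> simp⟩
    have hsub : Clause.toLinClause c ⊆ pathClause ρ done :=
      toLinClause_subset_pathClause (fun l hl => by simpa using hvars c hc l hl) hcfalse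
    set l₁ : ResLinLine := ⟨Clause.toLinClause c, .initial⟩ with hl₁
    set l₂ : ResLinLine := ⟨pathClause ρ done, .weaken π₀.length⟩ with hl₂
    refine ⟨[l₁, l₂], ⟨by simp, ?_, ?_⟩, ?_, ?_, by simp⟩
    · intro l hl p hp
      simp only [List.mem_cons, List.not_mem_nil, or_false] at hl
      rcases hl with rfl | rfl
      · simp [l₁, ResLinLine.premises, ResLinRule.premises] at hp
      · simp only [l₂, ResLinLine.premises, ResLinRule.premises, List.mem_singleton] at hp
        subst hp; simp
    · intro i
      simp only [List.map_cons, List.map_nil, List.sum_cons, List.sum_nil, add_zero, l₁, l₂,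
        ResLinLine.premises, ResLinRule.premises, List.count_nil, zero_add]
      rw [List.count_singleton]; split_ifs <;> simp
    · have h1 : IsResLinDerivation φ (π₀ ++ [l₁]) :=
        hπ₀.append_line (IsValidResLinLine.of_initial (l := l₁) rfl hc rfl)
      have h2 : IsResLinDerivation φ (π₀ ++ [l₁] ++ [l₂]) := by
        refine h1.append_line (IsValidResLinLine.of_weaken (l := l₂) (i := π₀.length) rfl
          (by simp) fun σ hσ => ?_)
        have hget : (π₀ ++ [l₁])[π₀.length]'(by simp) = l₁ := by simp
        rw [hget] at hσ
        exact LinClause.eval_mono hsub hσ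
      simpa using h2
    · intro hne
      simp [l₂]
  | cons x todo ih =>
    intro done ρ π₀ hvars hdisj hnodup hπ₀
    have hxtodo : x ∉ todo := (List.nodup_cons.1 hnodup).1
    have hnodup' : todo.Nodup := (List.nodup_cons.1 hnodup).2
    have hxdone : x ∉ done := hdisj x List.mem_cons_self
    have hvars' : ∀ c ∈ φ, ∀ l ∈ c, l.1 ∈ todo ∨ l.1 ∈ x :: done := by
      intro c hc l hl
      rcases hvars c hc l hl with h | h
      · rcases List.mem_cons.1 h with h | h
        · exact Or.inr (h ▸ List.mem_cons_self)
        · exact Or.inl h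
      · exact Or.inr (List.mem_cons_of_mem _ h)
    have hdisj' : ∀ y ∈ todo, y ∉ x :: done := by
      intro y hy hy'
      rcases List.mem_cons.1 hy' with rfl | hy'
      · exact hxtodo hy
      · exact hdisj y (List.mem_cons_of_mem _ hy) hy'
    -- the two children: `x ↦ true` (clause `… ∨ (x = 0)`) and `x ↦ false` (clause `… ∨ (x = 1)`)
    set ρ₁ : ℕ → Bool := Function.update ρ x true with hρ₁
    set ρ₀ : ℕ → Bool := Function.update ρ x false with hρ₀
    have hpc₁ : pathClause ρ₁ (x :: done) = insert (({x} : Finset ℕ), false) (pathClause ρ done) := by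
      rw [pathClause_cons, pathClause_congr (ρ' := ρ) fun y hy => by
        rw [hρ₁, Function.update_of_ne (ne_of_mem_of_not_mem hy hxdone)]]
      simp [hρ₁]
    have hpc₀ : pathClause ρ₀ (x :: done) = insert (({x} : Finset ℕ), true) (pathClause ρ done) := by
      rw [pathClause_cons, pathClause_congr (ρ' := ρ) fun y hy => by
        rw [hρ₀, Function.update_of_ne (ne_of_mem_of_not_mem hy hxdone)]]
      simp [hρ₀]
    obtain ⟨τ₁, hfresh₁, hder₁, hlast₁, hlen₁⟩ := ih (x :: done) ρ₁ π₀ hvars' hdisj' hnodup' hπ₀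
    obtain ⟨τ₂, hfresh₂, hder₂, hlast₂, hlen₂⟩ :=
      ih (x :: done) ρ₀ (π₀ ++ τ₁) hvars' hdisj' hnodup' hder₁
    rw [List.length_append] at hfresh₂
    have hne₁ := hfresh₁.ne
    have hne₂ := hfresh₂.ne
    have hl₁pos : 0 < τ₁.length := List.length_pos_iff.2 hne₁
    have hl₂pos : 0 < τ₂.length := List.length_pos_iff.2 hne₂
    -- the resolution line on the form `{x}`
    set i₁ := π₀.length + τ₁.length - 1 with hi₁
    set i₂ := π₀.length + τ₁.length + τ₂.length - 1 with hi₂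
    set l : ResLinLine := ⟨pathClause ρ done, .resolve i₁ i₂ {x}⟩ with hl
    refine ⟨τ₁ ++ τ₂ ++ [l], hfresh₁.glue hfresh₂ l (by simp [l, ResLinLine.premises,
      ResLinRule.premises, hi₁, hi₂]), ?_, ?_, ?_⟩
    · -- validity of the resolution line over the prefix `π₀ ++ τ₁ ++ τ₂`
      have hpre : IsResLinDerivation φ (π₀ ++ τ₁ ++ τ₂) := hder₂
      have hlen : (π₀ ++ τ₁ ++ τ₂).length = π₀.length + τ₁.length + τ₂.length := by
        simp only [List.length_append]
      have hi₁lt : i₁ < (π₀ ++ τ₁ ++ τ₂).length := by rw [hlen]; omega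
      have hi₂lt : i₂ < (π₀ ++ τ₁ ++ τ₂).length := by rw [hlen]; omega
      have hget₁ : ((π₀ ++ τ₁ ++ τ₂)[i₁]'hi₁lt).clause = insert (({x} : Finset ℕ), false)
          (pathClause ρ done) := by
        rw [List.getElem_append_left (by simp; omega), List.getElem_append_right (by omega)]
        have : τ₁[i₁ - π₀.length]'(by omega) = τ₁.getLast hne₁ := by
          rw [List.getLast_eq_getElem]; congr 1; omega
        rw [this, hlast₁ hne₁, hpc₁]
      have hget₂ : ((π₀ ++ τ₁ ++ τ₂)[i₂]'hi₂lt).clause = insert (({x} : Finset ℕ), true)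
          (pathClause ρ done) := by
        rw [List.getElem_append_right (by simp; omega)]
        have : τ₂[i₂ - (π₀ ++ τ₁).length]'(by simp; omega) = τ₂.getLast hne₂ := by
          rw [List.getLast_eq_getElem]; congr 1; simp; omega
        rw [this, hlast₂ hne₂, hpc₀]
      have hstep := hpre.append_line (IsValidResLinLine.of_resolve (l := l) rfl hi₁lt hi₂lt hget₁ hget₂
        (by simp [l]))
      simpa [List.append_assoc] using hstep
    · intro hne
      rw [List.getLast_append_of_ne_nil _ (by simp)]
      simp [l]
    · simp only [List.length_append, List.length_cons, List.length_nil, pow_succ]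
      omega

/-- **Tree-like Res(⊕) is complete, with the decision-tree bound**: an unsatisfiable CNF all of
whose variables lie in a duplicate-free list `V` has a TREE-LIKE Res(⊕) refutation (every line
used as a premise at most once) with exactly `3 · 2^|V| − 1` lines. [Itsykson–Sokolov 2020, §2
(completeness: splitting over all variables); Krajíček 2019, §5.2 (R* is complete)]
[cite: ItsyksonSokolov2020, §2] -/
theorem exists_treeLike_isResLinRefutation (hφ : ¬ φ.Satisfiable) {V : List ℕ} (hV : V.Nodup)
    (hvars : ∀ c ∈ φ, ∀ l ∈ c, l.1 ∈ V) :
    ∃ π : List ResLinLine, IsResLinRefutation φ π ∧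
      (∀ i : ℕ, (π.map fun l => l.premises.count i).sum ≤ 1) ∧ π.length + 1 = 3 * 2 ^ V.length := by
  obtain ⟨τ, hfresh, hder, hlast, hlen⟩ := exists_freshBlock_pathClause hφ V [] (fun _ => false) []
    (fun c hc l hl => Or.inl (hvars c hc l hl)) (by simp) hV (by intro k hk; simp at hk)
  refine ⟨τ, ⟨by simpa using hder, τ.getLast hfresh.ne, List.getLast_mem _, ?_⟩, hfresh.count, hlen⟩
  rw [hlast hfresh.ne, pathClause_nil]

/-- The variables of a CNF, listed without duplicates (helper for the size bound in terms of the
number of variables). [folklore] -/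
theorem exists_treeLike_isResLinRefutation_card (hφ : ¬ φ.Satisfiable) :
    ∃ π : List ResLinLine, IsResLinRefutation φ π ∧
      (∀ i : ℕ, (π.map fun l => l.premises.count i).sum ≤ 1) ∧
      π.length + 1 = 3 * 2 ^ (CNF.vars φ).card := by
  classical
  have hvars : ∀ c ∈ φ, ∀ l ∈ c, l.1 ∈ (CNF.vars φ).toList := by
    intro c hc l hl
    rw [Finset.mem_toList]
    simp only [CNF.vars, List.mem_toFinset, List.mem_map, List.mem_flatten]
    exact ⟨l, ⟨c, hc, hl⟩, rfl⟩
  obtain ⟨π, hπ, htree, hlen⟩ :=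
    exists_treeLike_isResLinRefutation hφ (Finset.nodup_toList _) hvars
  exact ⟨π, hπ, htree, by rwa [Finset.length_toList] at hlen⟩

end Construction

end Literature.Computability.MetaComplexity
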